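import Summits.SmoothPoincare4.SmoothPoincare4.Theorems.SullivanDualTargetCroftonPencilDefs
import Summits.SmoothPoincare4.SmoothPoincare4.Theorems.SullivanDualWitnessChargeFlatChart
import Summits.SmoothPoincare4.SmoothPoincare4.Theorems.SullivanDualWitnessChargeSubstubFar

/-!
# Helper `helper_flatPencilCertificate` of the line `crofton-pencil-laminar-charge` for crux `Target`
(item stmt-SmoothPoincare4-7823, route route-SmoothPoincare4-SullivanDual; vocabulary
`SullivanDualTargetCroftonPencilDefs.lean`, flat end chart `SullivanDualWitnessChargeFlatChart.lean`)

In the FLAT REGION — the punctured `ε'`-chart-ball at `p`, on which the crux's `J` is standard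
(`⟪Dψ (J v), c⟫ = ω₀(Dψ v, c)` for `ψ = ι ∘ (e − e p)`, i.e. `J` is multiplication by `i` in the
complex flat coordinates `Ycoord p = (z, w)`) — the intercept maps of the two pencils of chart `σ`,
`x ↦ (Yc σ p x).2 − a · (Yc σ p x).1` (the intercept `b` of the line `w = a z + b`, resp.
`z = a w + b`, through `x`), satisfy at every point `x` of the ball:

* (Q2) POSITIVELY ORIENTED `J`-COMPLEX TRANSVERSE DIFFERENTIAL `L = d_x(…)`:
  `L v ≠ 0 → 0 < Re (L v) · Im (L (J v)) − Im (L v) · Re (L (J v))` — indeed `L (J v) = i · L v`;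
* (Q3) TRANSVERSE PENCILS: a nonzero tangent vector is tangent to at most one line of the pencil,
  `v ≠ 0 → L_a v = 0 → L_{a'} v = 0 → a = a'`.

Proof.  `Ycoord p` is `C^∞` on the ball with `realify ∘ D(Ycoord p)(x) = Dψ(x)`
(`realify_mfderiv_Ycoord`) and `Dψ(x)` injective (`injective_Dpsi`), so `D(Ycoord p)(x)` is
injective; standardness gives `Dψ (J v) = J₀ (Dψ v)` (`inner_J0`, `eq_of_inner_eq`), and
`J₀ ∘ realify = realify ∘ (i • ·)`, hence `D(Ycoord p)(x) (J v) = i • D(Ycoord p)(x) v`.  The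
intercept map is `ℓ ∘ Ycoord p` for the `ℂ`-linear functional `ℓ (z, w) = w − a z` (resp. `z − a w`),
so `L = ℓ ∘ D(Ycoord p)(x)` and `L (J v) = i · L v`; (Q2) is `Re c ² + Im c ² > 0` for
`c = L v ≠ 0`, and (Q3) is the linear algebra `q ≠ 0, q₂ = a q₁, q₂ = a' q₁ ⇒ a = a'` applied to
`q = D(Ycoord p)(x) v ≠ 0` (components swapped for `σ = true`).
-/

noncomputable section

-- the prescribed namespace `Summit.<P>.<Sub>.…` duplicates `SmoothPoincare4` (P = Sub)
set_option linter.dupNamespace false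

open scoped Manifold ContDiff Topology ENNReal NNReal
open Set Filter MeasureTheory Literature.Geometry.Kaehler Literature.Geometry.Symplectic
  Literature.Topology.FourManifolds
open Summit.SmoothPoincare4.SmoothPoincare4.Theorems.WitnessCharge.PencilIncompleteness

namespace Summit.SmoothPoincare4.SmoothPoincare4.Theorems.Target.CroftonPencil

variable {S : HomotopySphere 4} {p : S.carrier} {ε' : ℝ}

/-! ### Flat linear algebra on `ℂ × ℂ` -/

/-- `J₀` is multiplication by `i` in the complex flat coordinates:
`J₀ (realify q) = realify (i • q)`. -/
theorem J0_realify (q : ℂ × ℂ) : J0 (realify q) = realify (Complex.I • q) := by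
  ext i
  fin_cases i <;> simp [realify, J0]

/-- The oriented area `Re c · Im (i c) − Im c · Re (i c) = |c|²` is positive for `c ≠ 0`. -/
theorem re_mul_im_I_mul_sub_pos {c : ℂ} (hc : c ≠ 0) :
    0 < c.re * (Complex.I * c).im - c.im * (Complex.I * c).re := by
  have h : c.re * (Complex.I * c).im - c.im * (Complex.I * c).re = Complex.normSq c := by
    rw [Complex.normSq_apply, Complex.mul_re, Complex.mul_im, Complex.I_re, Complex.I_im]
    ring
  rw [h]
  exact Complex.normSq_pos.2 hc

/-- Transverse pencils, linear-algebra core: a nonzero vector `q = (q₁, q₂)` of `ℂ × ℂ` with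
`q₂ = a q₁` and `q₂ = a' q₁` forces `a = a'`. -/
theorem eq_of_snd_sub_mul_fst_eq_zero {q : ℂ × ℂ} (hq : q ≠ 0) {a a' : ℂ}
    (ha : q.2 - a * q.1 = 0) (ha' : q.2 - a' * q.1 = 0) : a = a' := by
  have h1 : (a - a') * q.1 = 0 := by linear_combination ha' - ha
  rcases mul_eq_zero.1 h1 with h | h
  · exact sub_eq_zero.1 h
  · exfalso
    apply hq
    rw [h, mul_zero, sub_zero] at ha
    exact Prod.ext h ha

/-- The intercept functional of chart `σ` and direction `a` is `ℂ`-linear: there is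
`ℓ : ℂ × ℂ →L[ℂ] ℂ` with `ℓ q = q'.2 − a q'.1`, `q' = (q.2, q.1)` if `σ` else `q`. -/
theorem exists_interceptCLM (σ : Bool) (a : ℂ) :
    ∃ ℓ : ℂ × ℂ →L[ℂ] ℂ, ∀ q : ℂ × ℂ,
      ℓ q = (if σ then (q.2, q.1) else q).2 - a * (if σ then (q.2, q.1) else q).1 := by
  cases σ
  · exact ⟨ContinuousLinearMap.snd ℂ ℂ ℂ - a • ContinuousLinearMap.fst ℂ ℂ ℂ, fun q => by simp⟩
  · exact ⟨ContinuousLinearMap.fst ℂ ℂ ℂ - a • ContinuousLinearMap.snd ℂ ℂ ℂ, fun q => by simp⟩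

/-- A `ℂ`-linear functional commutes with multiplication by `i`: `ℓ (i • q) = i · ℓ q`. -/
theorem clm_apply_I_smul (ℓ : ℂ × ℂ →L[ℂ] ℂ) (q : ℂ × ℂ) :
    ℓ (Complex.I • q) = Complex.I * ℓ q := by
  rw [map_smul, smul_eq_mul]

/-! ### The differential of `Ycoord p` on the punctured chart-ball -/

/-- On the punctured chart-ball the differential `D(Ycoord p)(x)` is injective
(`realify ∘ D(Ycoord p)(x) = Dψ(x)` is injective). -/
theorem injective_mfderiv_Ycoord {x : punctured p} (hx : InPuncturedChartBall p ε' x) :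
    Function.Injective (mfderiv (𝓡 4) 𝓘(ℝ, ℂ × ℂ) (Ycoord p) x) := by
  intro v w h
  apply injective_Dpsi hx
  have h2 := congrArg realify h
  rw [realify_mfderiv_Ycoord hx v, realify_mfderiv_Ycoord hx w] at h2
  exact h2

/-- STANDARDNESS in complex flat coordinates: if `⟪Dψ w, c⟫ = ω₀(Dψ v, c)` for all `c` (the
crux's standardness hypothesis for `w = J v`), then `D(Ycoord p)(x) w = i • D(Ycoord p)(x) v`
(scalar multiplication of `ℂ × ℂ`, the tangent space `TangentSpace 𝓘(ℝ, ℂ × ℂ) _` being `ℂ × ℂ`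
by definition). -/
theorem mfderiv_Ycoord_eq_I_smul {x : punctured p} (hx : InPuncturedChartBall p ε' x)
    {v w : TangentSpace (𝓡 4) x}
    (h : ∀ c : EuclideanSpace ℝ (Fin 4),
      inner ℝ (fderiv ℝ inversion (extChartAt (𝓡 4) p x.1 - extChartAt (𝓡 4) p p)
        (mfderiv (𝓡 4) 𝓘(ℝ, EuclideanSpace ℝ (Fin 4))
          (fun z : punctured p => extChartAt (𝓡 4) p z.1) x w)) c
      = stdSymplecticForm (fderiv ℝ inversion (extChartAt (𝓡 4) p x.1 - extChartAt (𝓡 4) p p)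
        (mfderiv (𝓡 4) 𝓘(ℝ, EuclideanSpace ℝ (Fin 4))
          (fun z : punctured p => extChartAt (𝓡 4) p z.1) x v)) c) :
    mfderiv (𝓡 4) 𝓘(ℝ, ℂ × ℂ) (Ycoord p) x w =
      HSMul.hSMul (β := ℂ × ℂ) (γ := ℂ × ℂ) Complex.I
        (mfderiv (𝓡 4) 𝓘(ℝ, ℂ × ℂ) (Ycoord p) x v) := by
  apply realify_injective
  rw [← J0_realify, realify_mfderiv_Ycoord hx w, realify_mfderiv_Ycoord hx v]
  apply eq_of_inner_eq
  intro c
  rw [h c, inner_J0]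

/-- Chain rule: for a `ℂ`-linear functional `ℓ`, `x ↦ ℓ (Ycoord p x)` has differential
`ℓ ∘ D(Ycoord p)(x)` at every point of the punctured chart-ball. -/
theorem hasMFDerivAt_clm_Ycoord {x : punctured p} (hx : InPuncturedChartBall p ε' x)
    (ℓ : ℂ × ℂ →L[ℂ] ℂ) :
    HasMFDerivAt (𝓡 4) 𝓘(ℝ, ℂ) (fun y : punctured p => ℓ (Ycoord p y)) x
      ((ℓ.restrictScalars ℝ).comp (mfderiv (𝓡 4) 𝓘(ℝ, ℂ × ℂ) (Ycoord p) x)) := by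
  have hY : HasMFDerivAt (𝓡 4) 𝓘(ℝ, ℂ × ℂ) (Ycoord p) x
      (mfderiv (𝓡 4) 𝓘(ℝ, ℂ × ℂ) (Ycoord p) x) :=
    ((contMDiffAt_Ycoord hx).mdifferentiableAt (by simp)).hasMFDerivAt
  exact HasMFDerivAt.comp x (g := ℓ.restrictScalars ℝ) (f := Ycoord p)
    (ℓ.restrictScalars ℝ).hasMFDerivAt hY

/-! ### The intercept maps of the flat pencils -/

/-- The differential of the intercept map `x ↦ (Yc σ p x).2 − a · (Yc σ p x).1` at a point of the
punctured chart-ball is `ℓ ∘ D(Ycoord p)(x)` for the `ℂ`-linear intercept functional `ℓ` of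
`exists_interceptCLM`. -/
theorem mfderiv_interceptMap {x : punctured p} (hx : InPuncturedChartBall p ε' x)
    (σ : Bool) (a : ℂ) :
    ∃ ℓ : ℂ × ℂ →L[ℂ] ℂ,
      (∀ q : ℂ × ℂ, ℓ q = (if σ then (q.2, q.1) else q).2 - a * (if σ then (q.2, q.1) else q).1) ∧
      ∀ v : TangentSpace (𝓡 4) x,
        mfderiv (𝓡 4) 𝓘(ℝ, ℂ) (fun y : punctured p => (Yc σ p y).2 - a * (Yc σ p y).1) x v =
          ℓ (mfderiv (𝓡 4) 𝓘(ℝ, ℂ × ℂ) (Ycoord p) x v) := by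
  obtain ⟨ℓ, hℓ⟩ := exists_interceptCLM σ a
  refine ⟨ℓ, hℓ, fun v => ?_⟩
  have hf : (fun y : punctured p => (Yc σ p y).2 - a * (Yc σ p y).1) =
      fun y : punctured p => ℓ (Ycoord p y) := by
    funext y
    rw [hℓ]
    rfl
  rw [hf, (hasMFDerivAt_clm_Ycoord hx ℓ).mfderiv]
  rfl

/-! ### The registered helper -/

/-- **Registered helper `helper_flatPencilCertificate`** (line `crofton-pencil-laminar-charge`,
crux `Target`): for `J` standard on the punctured `ε'`-chart-ball at `p`, the flat intercept maps
`x ↦ (Yc σ p x).2 − a · (Yc σ p x).1` of both charts `σ` have, at every point of the ball,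
(Q2) a positively oriented `J`-complex transverse differential
(`L v ≠ 0 → 0 < Re (L v) Im (L (J v)) − Im (L v) Re (L (J v))`) and (Q3) transverse pencils
(`v ≠ 0 → L_a v = 0 → L_{a'} v = 0 → a = a'`). -/
theorem helper_flatPencilCertificate :
    ∀ (S : HomotopySphere 4) (p : S.carrier)
      (J : ∀ x : punctured p, TangentSpace (𝓡 4) x →L[ℝ] TangentSpace (𝓡 4) x) (ε' : ℝ),
      0 < ε' →
      (∀ x : punctured p, InPuncturedChartBall p ε' x →
        ∀ (v : TangentSpace (𝓡 4) x) (b : EuclideanSpace ℝ (Fin 4)),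
          inner ℝ (fderiv ℝ inversion (extChartAt (𝓡 4) p x.1 - extChartAt (𝓡 4) p p)
            (mfderiv (𝓡 4) 𝓘(ℝ, EuclideanSpace ℝ (Fin 4))
              (fun z : punctured p => extChartAt (𝓡 4) p z.1) x (J x v))) b
          = stdSymplecticForm (fderiv ℝ inversion (extChartAt (𝓡 4) p x.1 - extChartAt (𝓡 4) p p)
            (mfderiv (𝓡 4) 𝓘(ℝ, EuclideanSpace ℝ (Fin 4))
              (fun z : punctured p => extChartAt (𝓡 4) p z.1) x v)) b) →
      ∀ (σ : Bool) (x : punctured p), InPuncturedChartBall p ε' x →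
        (∀ (a : ℂ) (v : TangentSpace (𝓡 4) x),
          mfderiv (𝓡 4) 𝓘(ℝ, ℂ) (fun y : punctured p => (Yc σ p y).2 - a * (Yc σ p y).1) x v ≠ 0 →
          0 < (mfderiv (𝓡 4) 𝓘(ℝ, ℂ) (fun y : punctured p => (Yc σ p y).2 - a * (Yc σ p y).1) x v).re *
                (mfderiv (𝓡 4) 𝓘(ℝ, ℂ) (fun y : punctured p => (Yc σ p y).2 - a * (Yc σ p y).1) x (J x v)).im
            - (mfderiv (𝓡 4) 𝓘(ℝ, ℂ) (fun y : punctured p => (Yc σ p y).2 - a * (Yc σ p y).1) x v).im *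
                (mfderiv (𝓡 4) 𝓘(ℝ, ℂ) (fun y : punctured p => (Yc σ p y).2 - a * (Yc σ p y).1) x (J x v)).re) ∧
        (∀ (v : TangentSpace (𝓡 4) x) (a a' : ℂ), v ≠ 0 →
          mfderiv (𝓡 4) 𝓘(ℝ, ℂ) (fun y : punctured p => (Yc σ p y).2 - a * (Yc σ p y).1) x v = 0 →
          mfderiv (𝓡 4) 𝓘(ℝ, ℂ) (fun y : punctured p => (Yc σ p y).2 - a' * (Yc σ p y).1) x v = 0 →
          a = a') := by
  intro S p J ε' _hε' hJstd σ x hx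
  refine ⟨fun a v hv => ?_, fun v a a' hv ha ha' => ?_⟩
  · -- (Q2): `L (J v) = i · L v`
    obtain ⟨ℓ, -, hD⟩ := mfderiv_interceptMap hx σ a
    rw [hD] at hv
    rw [hD, hD, mfderiv_Ycoord_eq_I_smul hx (hJstd x hx v), clm_apply_I_smul]
    exact re_mul_im_I_mul_sub_pos hv
  · -- (Q3): `D(Ycoord p)(x) v ≠ 0` lies on at most one line of the pencil
    obtain ⟨ℓ, hℓ, hD⟩ := mfderiv_interceptMap hx σ a
    obtain ⟨ℓ', hℓ', hD'⟩ := mfderiv_interceptMap hx σ a'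
    rw [hD, hℓ] at ha
    rw [hD', hℓ'] at ha'
    have hq : (mfderiv (𝓡 4) 𝓘(ℝ, ℂ × ℂ) (Ycoord p) x v : ℂ × ℂ) ≠ 0 := fun h0 =>
      hv (injective_mfderiv_Ycoord hx (h0.trans (map_zero _).symm))
    cases σ
    · simp only [Bool.false_eq_true, ↓reduceIte] at ha ha'
      exact eq_of_snd_sub_mul_fst_eq_zero hq ha ha'
    · simp only [↓reduceIte] at ha ha'
      have hq' : (((mfderiv (𝓡 4) 𝓘(ℝ, ℂ × ℂ) (Ycoord p) x v : ℂ × ℂ).2,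
          (mfderiv (𝓡 4) 𝓘(ℝ, ℂ × ℂ) (Ycoord p) x v : ℂ × ℂ).1) : ℂ × ℂ) ≠ 0 := fun h0 =>
        hq (Prod.ext (congrArg Prod.snd h0) (congrArg Prod.fst h0))
      exact eq_of_snd_sub_mul_fst_eq_zero hq' ha ha'

end Summit.SmoothPoincare4.SmoothPoincare4.Theorems.Target.CroftonPencil

end
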